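import Literature.NumberTheory.EllipticCurves.Kato2004.EulerSystemDefinedValues
import HarnessLib

/-!
# F″ programme, piece P4-core: the SEMI-LOCAL DESCENT — per-factor `𝒪_w`-integrality at the places
# `w ∣ p` of the RATIONAL value `x ∈ ℚ(ζ_m)` gives `p`-integrality of every character sum
# `Σ_b χ(b)·ι(σ_b x)` in `ℂ` (the conclusion shape of `kato_neron_isIntegral_twistedSymbolSum_of_additive_five_le`)

Cell `pub/bsd-wall`, seat `bsd-wall-manin-p1` g8 (explicit-unit; crux of record stmt-BirchSwinnertonDyer-20709
`ManinFrameResidueProperR`, which is a tree theorem GRANTED the cite-only fact F″ =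
`Literature.NumberTheory.EllipticCurves.kato_neron_isIntegral_twistedSymbolSum_of_additive_five_le`
(`…Theorems.ManinFrameResidueProperROfKatoLTwist.maninFrameResidueProperR_of_kato`, p596221)); `--supports
stmt-BirchSwinnertonDyer-20709` (helper). TOOL theorems only: no definition, no named fact, no `sorry`, nothing
asserted about any curve; BSD / 20709 / 22226 are not proved by any of this.

WHY. The F″ programme of `Cruxes/StarredOptimalManinUnitFiveSeven/Lines/kato-lever-F2-programme.md` (seat
bsd-line-edix-p1 g4, §4) discharges F″ from: P1 (Kato's zeta elements with values in a NÉRON coordinate — a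
`Kato2004.DefinedExpStarBody`-shaped cite fact, to be typed), the receptacle P2/P3 (per-factor: the Néron-pinned
dual exponential of a class lands in `𝒪_{L_w}` at every place `w ∣ p` of `L = ℚ(ζ_m)`; seats edix-p1 g5 /
edix-p5 g2 / edix-p2 g4), P4 (semi-local assembly) and P6 (prime-to-`p` transport; edix-p4 g2). This file is the
part of P4 that does NOT depend on P1's final normalisation: once the receptacle says that the semi-local value
`Ψ(Λ z) = Ψ(1 ⊗ x)` has every `w`-component in `𝒪_{L_w}` (`(C4)`: `Λ z = 1 ⊗ x`, `x ∈ ℚ(ζ_m)` RATIONAL, Kato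
Thm. 9.7), the GLOBAL element `x` is integral at every place over `p`, hence `s·x ∈ 𝓞_{ℚ(ζ_m)}` for some
`s ∈ ℕ` prime to `p`, hence every character sum `Σ_b χ(b) ι(σ_b x)` (= `EulerSystemValues.charSum`, the left side
of the value law `(C5)`) satisfies `∃ s, p ∤ s ∧ IsIntegral ℤ (s · charSum …)` — EXACTLY the conclusion shape of
F″. What remains of P4 after this file is the value-law bookkeeping (`(C5)` with P1's Néron constant ⟹ F″'s `r`
via Birch's formula, Gauss sums and the unit `T_{c,d}(χ)`), which waits for P1.

CONTENTS (all `p`-generic and `m`-generic; no `p ∤ m`, no parity, no reduction hypothesis):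
* §1 `exists_not_dvd_natCast_mul_mem_of_forall_valuation_le_one` — `K` any number field, `x ∈ K` with
  `v_w(x) ≥ 0` at every finite place `w` with `p ∈ w`: `∃ s ∈ ℕ, p ∤ s, s·x ∈ 𝓞_K` (valuations + `n = p^e·s`);
  `…_isIntegral_…` the `IsIntegral ℤ` form; `…_of_forall_mem_adicCompletionIntegers` the completed form.
* §2 `natCast_mem_asIdeal_of_extension` / `under_eq_of_natCast_mem_asIdeal` — the places over `p` in the
  `HeightOneSpectrum.Extension` currency of `Kato2004.DefinedExpStarBody` are exactly the `w` with `p ∈ w`.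
* §3 `isIntegral_dirichletCharacter_apply_units`, `isIntegral_charSum_of_isIntegral`, `charSum_natCast_mul`,
  ★ `exists_not_dvd_isIntegral_charSum_of_forall_valuation_le_one`.
* §4 ★★ `exists_not_dvd_isIntegral_charSum_of_forall_semilocal_mem` — in the `(Ψ, hΨ)` currency of
  `DefinedExpStarBody`: `∀ w, Ψ(1 ⊗ x) w ∈ 𝒪_w` ⟹ `∃ s, p ∤ s ∧ IsIntegral ℤ (s · charSum m ι χ x)`;
  `semilocal_mem_of_galAdicCompletionMap_eq` — the (DEF) clause read at ONE place `w₀` propagates integrality to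
  every `w` (`galAdicCompletionMap_mem_adicCompletionIntegers_iff`).

References: J. Neukirch, *Algebraic Number Theory* (1999), Ch. I (11.5)/(12.x) (integrality is detected by the
valuations) and Ch. II (8.x) (completions) [folklore]; [CasselsFrohlichANT1967] Ch. II §10 (the semi-local
decomposition `ℚ_p ⊗ L ≃ ∏_{w∣p} L_w`), Ch. VII §1.1; K. Kato, Astérisque 295 (2004) Thm. 9.7 p. 189 (RATIONALITY
of the values, `(C4)`) and Thm. 6.6 (1) p. 163 (the character sums, `(C5)`) [Kato2004Asterisque] — context only,
nothing of Kato is used or restated here.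
-/

set_option autoImplicit false
-- the Theorems namespace of a single-conjunct summit repeats the summit name by design (D-0017)
set_option linter.dupNamespace false
-- `CyclotomicField m ℚ`'s two `ℚ`-algebra structures agree only up to unfolding (as in the W2 sibling files)
set_option backward.isDefEq.respectTransparency false

noncomputable section

open scoped NumberField TensorProduct BigOperators
open IsDedekindDomain NumberField
open Literature.NumberTheory.EllipticCurves.Kato2004.EulerSystemValues

namespace Summit.BirchSwinnertonDyer.BirchSwinnertonDyer.Theorems.SemiLocalDescent

/-! ## §1 Number-field descent: integrality at the places over `p` ⟹ `p′`-integrality -/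

section NumberFieldDescent

variable {K : Type*} [Field K] [NumberField K] (p : ℕ) [hp : Fact p.Prime]

omit hp in
/-- At a finite place `w` NOT over `p`, the prime `p` is a `w`-adic unit. [folklore] -/
theorem valuation_natCast_eq_one_of_not_mem (w : HeightOneSpectrum (𝓞 K))
    (hw : (p : 𝓞 K) ∉ w.asIdeal) : w.valuation K (p : K) = 1 := by
  have h : (p : K) = algebraMap (𝓞 K) K (p : 𝓞 K) := by rw [map_natCast]
  rw [h]
  exact (w.valuation_eq_one_iff_notMem (K := K)).mpr hw

/-- **Descent.** For `x` in a number field `K` and a prime `p`: if `x` is integral at every finite place `w`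
of `K` lying over `p` (`p ∈ w`), then `s · x ∈ 𝓞_K` for some natural number `s` prime to `p`.
Proof: some non-zero `n ∈ ℤ` has `n·x` integral; write `|n| = p^e · s` with `p ∤ s`; at `w ∣ p` the valuation
of `s·x` is `≤ 1` by hypothesis, at `w ∤ p` it equals that of `|n|·x` because `p` is a `w`-unit; integrality is
detected by the valuations (Mathlib `HeightOneSpectrum.mem_integers_of_valuation_le_one`). [folklore] -/
theorem exists_not_dvd_natCast_mul_mem_of_forall_valuation_le_one (x : K)
    (hx : ∀ w : HeightOneSpectrum (𝓞 K), (p : 𝓞 K) ∈ w.asIdeal → w.valuation K x ≤ 1) :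
    ∃ s : ℕ, ¬ p ∣ s ∧ ∃ y : 𝓞 K, (y : K) = (s : K) * x := by
  classical
  -- an integral multiple with a rational-integer multiplier
  obtain ⟨n, hn0, hn⟩ := exists_integral_multiples ℤ ℚ ({x} : Finset K)
  have hnx : IsIntegral ℤ (n • x) := hn x (Finset.mem_singleton_self x)
  -- pass to the natural number `N = |n|`
  set N : ℕ := n.natAbs with hN
  have hN0 : N ≠ 0 := Int.natAbs_ne_zero.mpr hn0
  have hNx : IsIntegral ℤ ((N : K) * x) := by
    rcases Int.natAbs_eq n with h | h
    · have : (N : K) * x = n • x := by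
        rw [zsmul_eq_mul, h, Int.cast_natCast]
      rw [this]; exact hnx
    · have : (N : K) * x = -(n • x) := by
        rw [zsmul_eq_mul, h, Int.cast_neg, Int.cast_natCast, neg_mul, neg_neg]
      rw [this]; exact hnx.neg
  -- `N·x` is an algebraic integer, i.e. an element of `𝓞 K`
  obtain ⟨y₀, hy₀⟩ : ∃ y₀ : 𝓞 K, (y₀ : K) = (N : K) * x :=
    ⟨⟨(N : K) * x, hNx⟩, rfl⟩
  -- split off the `p`-part of `N`
  obtain ⟨e, s, hs, hNe⟩ := Nat.exists_eq_pow_mul_and_not_dvd hN0 p hp.out.ne_one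
  refine ⟨s, hs, ?_⟩
  -- integrality of `s·x` is detected by the valuations
  have hval : ∀ w : HeightOneSpectrum (𝓞 K), w.valuation K ((s : K) * x) ≤ 1 := by
    intro w
    by_cases hw : (p : 𝓞 K) ∈ w.asIdeal
    · rw [map_mul]
      -- `v_w(s) ≤ 1` for the rational integer `s` (cf. `WeierstrassCurve.OggWild.valuation_natCast_le_one`)
      have hs1 : w.valuation K (s : K) ≤ 1 := by
        rw [show (s : K) = algebraMap (𝓞 K) K (s : 𝓞 K) by rw [map_natCast]]
        exact w.valuation_le_one _
      exact mul_le_one' hs1 (hx w hw)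
    · -- `p` is a `w`-unit, so `v_w(s x) = v_w(p^e s x) = v_w(N x) ≤ 1`
      have hpe : w.valuation K ((p : K) ^ e) = 1 := by
        rw [map_pow, valuation_natCast_eq_one_of_not_mem p w hw, one_pow]
      have hNx' : w.valuation K ((N : K) * x) ≤ 1 := by
        rw [← hy₀, show ((y₀ : K)) = algebraMap (𝓞 K) K y₀ from rfl]
        exact w.valuation_le_one _
      have hsplit : (N : K) * x = (p : K) ^ e * ((s : K) * x) := by
        rw [hNe]; push_cast; ring
      rw [hsplit, map_mul, hpe, one_mul] at hNx'
      exact hNx'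
  obtain ⟨y, hy⟩ :=
    HeightOneSpectrum.mem_integers_of_valuation_le_one (R := 𝓞 K) K ((s : K) * x) hval
  exact ⟨y, hy⟩

/-- **Descent, `IsIntegral ℤ` form**: under the hypothesis of
`exists_not_dvd_natCast_mul_mem_of_forall_valuation_le_one`, `s·x` is an algebraic integer for some `s ∈ ℕ`
with `p ∤ s`. [folklore] -/
theorem exists_not_dvd_isIntegral_natCast_mul_of_forall_valuation_le_one (x : K)
    (hx : ∀ w : HeightOneSpectrum (𝓞 K), (p : 𝓞 K) ∈ w.asIdeal → w.valuation K x ≤ 1) :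
    ∃ s : ℕ, ¬ p ∣ s ∧ IsIntegral ℤ ((s : K) * x) := by
  obtain ⟨s, hs, y, hy⟩ := exists_not_dvd_natCast_mul_mem_of_forall_valuation_le_one p x hx
  exact ⟨s, hs, hy ▸ y.isIntegral_coe⟩

/-- Dictionary: `x ∈ K` maps into the integers `𝒪_w` of the completion `K_w` iff `v_w(x) ≤ 1`. [folklore] -/
theorem algebraMap_mem_adicCompletionIntegers_iff (w : HeightOneSpectrum (𝓞 K)) (x : K) :
    algebraMap K (w.adicCompletion K) x ∈ w.adicCompletionIntegers K ↔ w.valuation K x ≤ 1 := by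
  rw [HeightOneSpectrum.mem_adicCompletionIntegers]
  show Valued.v (x : w.adicCompletion K) ≤ 1 ↔ _
  rw [HeightOneSpectrum.valuedAdicCompletion_eq_valuation']

/-- **Descent, completed form**: if the image of `x ∈ K` in `K_w` lies in `𝒪_w` for every place `w` over
`p`, then `s·x` is an algebraic integer for some `s ∈ ℕ`, `p ∤ s`. [folklore] -/
theorem exists_not_dvd_isIntegral_natCast_mul_of_forall_mem_adicCompletionIntegers (x : K)
    (hx : ∀ w : HeightOneSpectrum (𝓞 K), (p : 𝓞 K) ∈ w.asIdeal →
      algebraMap K (w.adicCompletion K) x ∈ w.adicCompletionIntegers K) :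
    ∃ s : ℕ, ¬ p ∣ s ∧ IsIntegral ℤ ((s : K) * x) :=
  exists_not_dvd_isIntegral_natCast_mul_of_forall_valuation_le_one p x fun w hw =>
    (algebraMap_mem_adicCompletionIntegers_iff w x).mp (hx w hw)

end NumberFieldDescent

/-! ## §2 The places over `p` in the `Extension` currency of `Kato2004.DefinedExpStarBody` -/

section Places

variable {K : Type*} [Field K] [NumberField K] (p : ℕ) [hp : Fact p.Prime]

/-- A place of `K` in the fibre `v_p.Extension (𝓞 K)` of the rational place `v_p` contains `p`
(the `p`-generic form of the W2 cell's `KimAtThreeFineKatoPerFactorPlaces.three_mem_asIdeal_extension`).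
[folklore] -/
theorem natCast_mem_asIdeal_of_extension
    (w : ((Rat.HeightOneSpectrum.primesEquiv (R := 𝓞 ℚ)).symm ⟨p, hp.out⟩).Extension (𝓞 K)) :
    (p : 𝓞 K) ∈ w.1.asIdeal := by
  have h0 : ((p : ℕ) : 𝓞 ℚ) ∈
      ((Rat.HeightOneSpectrum.primesEquiv (R := 𝓞 ℚ)).symm ⟨p, hp.out⟩).asIdeal :=
    (Literature.NumberTheory.EllipticCurves.natCast_mem_asIdeal_iff_eq_primesEquiv_symm _ hp.out).mpr rfl
  have h1 := w.2
  rw [HeightOneSpectrum.ext_iff] at h1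
  rw [← h1] at h0
  change ((p : ℕ) : 𝓞 ℚ) ∈ Ideal.comap (algebraMap (𝓞 ℚ) (𝓞 K)) w.1.asIdeal at h0
  rw [Ideal.mem_comap, map_natCast] at h0
  exact h0

/-- Conversely, a place `w` of `K` with `p ∈ w` lies in the fibre of `v_p`: `w.under (𝓞 ℚ) = v_p`.
[folklore] -/
theorem under_eq_of_natCast_mem_asIdeal (w : HeightOneSpectrum (𝓞 K)) (hw : (p : 𝓞 K) ∈ w.asIdeal) :
    w.under (𝓞 ℚ) = (Rat.HeightOneSpectrum.primesEquiv (R := 𝓞 ℚ)).symm ⟨p, hp.out⟩ := by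
  apply (Literature.NumberTheory.EllipticCurves.natCast_mem_asIdeal_iff_eq_primesEquiv_symm _ hp.out).mp
  change ((p : ℕ) : 𝓞 ℚ) ∈ Ideal.comap (algebraMap (𝓞 ℚ) (𝓞 K)) w.asIdeal
  rw [Ideal.mem_comap, map_natCast]
  exact hw

/-- A property holding at every place of the fibre `v_p.Extension (𝓞 K)` holds at every `w ∋ p`. [folklore] -/
theorem forall_of_forall_extension {P : HeightOneSpectrum (𝓞 K) → Prop}
    (h : ∀ w : ((Rat.HeightOneSpectrum.primesEquiv (R := 𝓞 ℚ)).symm ⟨p, hp.out⟩).Extension (𝓞 K), P w.1)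
    (w : HeightOneSpectrum (𝓞 K)) (hw : (p : 𝓞 K) ∈ w.asIdeal) : P w :=
  h ⟨w, under_eq_of_natCast_mem_asIdeal p w hw⟩

end Places

/-! ## §3 The archimedean exit: character sums of `p′`-integral elements are `p′`-integral in `ℂ` -/

section CharSum

variable (m : ℕ) [NeZero m]

/-- Values of a Dirichlet character on units are roots of unity, hence algebraic integers. [folklore] -/
theorem isIntegral_dirichletCharacter_apply_units (χ : DirichletCharacter ℂ m) (b : (ZMod m)ˣ) :
    IsIntegral ℤ (χ (b : ZMod m)) := by
  have hpow : (χ (b : ZMod m)) ^ Fintype.card (ZMod m)ˣ = 1 := by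
    rw [← map_pow, ← Units.val_pow_eq_pow_val, pow_card_eq_one, Units.val_one, map_one]
  exact IsIntegral.of_pow Fintype.card_pos (by rw [hpow]; exact isIntegral_one)

/-- The character sum `Σ_b χ(b)·ι(σ_b y)` of an algebraic integer `y ∈ 𝓞_{ℚ(ζ_m)}` is an algebraic integer
(`σ_b` preserves integrality, `ι` is a ring map, `χ(b)` is a root of unity). [folklore] -/
theorem isIntegral_charSum_of_isIntegral (ι : CyclotomicField m ℚ →+* ℂ) (χ : DirichletCharacter ℂ m)
    {y : CyclotomicField m ℚ} (hy : IsIntegral ℤ y) : IsIntegral ℤ (charSum m ι χ y) := by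
  unfold charSum
  refine IsIntegral.sum _ fun b _ => ?_
  exact (isIntegral_dirichletCharacter_apply_units m χ b).mul
    (map_isIntegral_int ι (map_isIntegral_int (sigma m b) hy))

/-- The character sum is `ℚ`-linear in its argument for natural-number scalars:
`charSum (s·x) = s · charSum x`. [folklore] -/
theorem charSum_natCast_mul (ι : CyclotomicField m ℚ →+* ℂ) (χ : DirichletCharacter ℂ m)
    (s : ℕ) (x : CyclotomicField m ℚ) :
    charSum m ι χ ((s : CyclotomicField m ℚ) * x) = (s : ℂ) * charSum m ι χ x := by
  unfold charSum
  rw [Finset.mul_sum]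
  refine Finset.sum_congr rfl fun b _ => ?_
  rw [map_mul, map_natCast, map_mul, map_natCast]
  ring

/-- ★ **Semi-local descent, archimedean exit.** If `x ∈ ℚ(ζ_m)` is integral at every place over `p`, then
for every Dirichlet character `χ` mod `m` and every embedding `ι : ℚ(ζ_m) → ℂ` there is `s ∈ ℕ`, `p ∤ s`, with
`s · Σ_b χ(b) ι(σ_b x)` an algebraic integer — the conclusion shape of
`Literature.NumberTheory.EllipticCurves.kato_neron_isIntegral_twistedSymbolSum_of_additive_five_le`. [folklore] -/
theorem exists_not_dvd_isIntegral_charSum_of_forall_valuation_le_one (p : ℕ) [hp : Fact p.Prime]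
    (ι : CyclotomicField m ℚ →+* ℂ) (χ : DirichletCharacter ℂ m) (x : CyclotomicField m ℚ)
    (hx : ∀ w : HeightOneSpectrum (𝓞 (CyclotomicField m ℚ)),
      (p : 𝓞 (CyclotomicField m ℚ)) ∈ w.asIdeal → w.valuation (CyclotomicField m ℚ) x ≤ 1) :
    ∃ s : ℕ, ¬ p ∣ s ∧ IsIntegral ℤ ((s : ℂ) * charSum m ι χ x) := by
  obtain ⟨s, hs, hint⟩ := exists_not_dvd_isIntegral_natCast_mul_of_forall_valuation_le_one p x hx
  exact ⟨s, hs, charSum_natCast_mul m ι χ s x ▸ isIntegral_charSum_of_isIntegral m ι χ hint⟩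

end CharSum

/-! ## §4 The adapter in the semi-local currency `(Ψ, hΨ)` of `Kato2004.DefinedExpStarBody` -/

section SemiLocal

open Literature.NumberTheory.Automorphic

variable (m p : ℕ) [NeZero m] [hp : Fact p.Prime]

/-- ★★ **Semi-local descent (core form).** Let `Ψ : ℚ_p ⊗ ℚ(ζ_m) → ∏_{w ∣ p} ℚ(ζ_m)_w` be ANY map that on
pure tensors `1 ⊗ x` is the diagonal embedding (`hΨ1`; e.g. the semi-local isomorphism of
[CasselsFrohlichANT1967] Ch. II §10, as carried by `Kato2004.DefinedExpStarBody`). If every `w`-component of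
`Ψ(1 ⊗ x)` is a `w`-adic integer, then for every Dirichlet character `χ` mod `m` and every embedding `ι` some
prime-to-`p` multiple of the character sum `Σ_b χ(b) ι(σ_b x)` is an algebraic integer. [folklore] -/
theorem exists_not_dvd_isIntegral_charSum_of_forall_semilocal_mem_of_diag
    (Ψ : ℚ_[p] ⊗[ℚ] CyclotomicField m ℚ →
      (Π w : ((Rat.HeightOneSpectrum.primesEquiv (R := 𝓞 ℚ)).symm ⟨p, hp.out⟩).Extension
        (𝓞 (CyclotomicField m ℚ)), w.1.adicCompletion (CyclotomicField m ℚ)))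
    (hΨ1 : ∀ (x : CyclotomicField m ℚ)
      (w : ((Rat.HeightOneSpectrum.primesEquiv (R := 𝓞 ℚ)).symm ⟨p, hp.out⟩).Extension
        (𝓞 (CyclotomicField m ℚ))),
      Ψ ((1 : ℚ_[p]) ⊗ₜ[ℚ] x) w =
        algebraMap (CyclotomicField m ℚ) (w.1.adicCompletion (CyclotomicField m ℚ)) x)
    (x : CyclotomicField m ℚ)
    (hx : ∀ w : ((Rat.HeightOneSpectrum.primesEquiv (R := 𝓞 ℚ)).symm ⟨p, hp.out⟩).Extension
        (𝓞 (CyclotomicField m ℚ)),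
      Ψ ((1 : ℚ_[p]) ⊗ₜ[ℚ] x) w ∈ w.1.adicCompletionIntegers (CyclotomicField m ℚ))
    (ι : CyclotomicField m ℚ →+* ℂ) (χ : DirichletCharacter ℂ m) :
    ∃ s : ℕ, ¬ p ∣ s ∧ IsIntegral ℤ ((s : ℂ) * charSum m ι χ x) := by
  refine exists_not_dvd_isIntegral_charSum_of_forall_valuation_le_one m p ι χ x fun w hw => ?_
  have h := hx ⟨w, under_eq_of_natCast_mem_asIdeal p w hw⟩
  rw [hΨ1] at h
  exact (algebraMap_mem_adicCompletionIntegers_iff w x).mp h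

/-- ★★ **Semi-local descent, in the VERBATIM currency of `Kato2004.DefinedExpStarBody`** (its binders `Ψ`,
`hΨ` at the level `m`, e.g. `m = cycLevel p k r`): if the semi-local value `y = Λ z` is the pure tensor `1 ⊗ x`
of a RATIONAL `x ∈ ℚ(ζ_m)` (`ZetaBody` (C4), Kato Thm. 9.7) and every `w`-component `Ψ y w` is a `w`-adic
integer (the receptacle output, P2/P3), then for every `χ` mod `m` and every `ι : ℚ(ζ_m) → ℂ`:
`∃ s, p ∤ s ∧ IsIntegral ℤ (s · charSum m ι χ x)` — the conclusion shape of
`Literature.NumberTheory.EllipticCurves.kato_neron_isIntegral_twistedSymbolSum_of_additive_five_le`.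
No `p ∤ m`, no hypothesis on `χ`. [folklore] -/
theorem exists_not_dvd_isIntegral_charSum_of_forall_semilocal_mem
    (Ψ : ℚ_[p] ⊗[ℚ] CyclotomicField m ℚ ≃ₐ[ℚ]
      (Π w : ((Rat.HeightOneSpectrum.primesEquiv (R := 𝓞 ℚ)).symm ⟨p, hp.out⟩).Extension
        (𝓞 (CyclotomicField m ℚ)), w.1.adicCompletion (CyclotomicField m ℚ)))
    (hΨ : ∀ (s : ℚ_[p]) (x : CyclotomicField m ℚ)
      (w : ((Rat.HeightOneSpectrum.primesEquiv (R := 𝓞 ℚ)).symm ⟨p, hp.out⟩).Extension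
        (𝓞 (CyclotomicField m ℚ))),
      Ψ (s ⊗ₜ[ℚ] x) w =
        algebraMap (CyclotomicField m ℚ) (w.1.adicCompletion (CyclotomicField m ℚ)) x *
        algebraMap (((Rat.HeightOneSpectrum.primesEquiv (R := 𝓞 ℚ)).symm ⟨p, hp.out⟩).adicCompletion ℚ)
          (w.1.adicCompletion (CyclotomicField m ℚ)) ((Padic.adicCompletionEquiv (𝓞 ℚ) ⟨p, hp.out⟩) s))
    (x : CyclotomicField m ℚ) (y : ℚ_[p] ⊗[ℚ] CyclotomicField m ℚ) (hy : y = (1 : ℚ_[p]) ⊗ₜ[ℚ] x)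
    (hint : ∀ w : ((Rat.HeightOneSpectrum.primesEquiv (R := 𝓞 ℚ)).symm ⟨p, hp.out⟩).Extension
        (𝓞 (CyclotomicField m ℚ)),
      Ψ y w ∈ w.1.adicCompletionIntegers (CyclotomicField m ℚ))
    (ι : CyclotomicField m ℚ →+* ℂ) (χ : DirichletCharacter ℂ m) :
    ∃ s : ℕ, ¬ p ∣ s ∧ IsIntegral ℤ ((s : ℂ) * charSum m ι χ x) := by
  subst hy
  refine exists_not_dvd_isIntegral_charSum_of_forall_semilocal_mem_of_diag m p Ψ (fun x' w => ?_) x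
    hint ι χ
  rw [hΨ, map_one, map_one, mul_one]

/-- The (DEF) clause of `Kato2004.DefinedExpStarBody` reads every `w`-component at ONE place `w₀` through a
Galois transport `σ_w : L_{w₀} → L_w` (`σ • w = w₀`); such transports preserve integers
(`galAdicCompletionMap_mem_adicCompletionIntegers_iff`), so a receptacle bound at `w₀` gives the per-factor
hypothesis `hint` of `exists_not_dvd_isIntegral_charSum_of_forall_semilocal_mem` at every `w`. [folklore] -/
theorem mem_adicCompletionIntegers_of_eq_galAdicCompletionMap {K : Type*} [Field K] [NumberField K]
    (σ : K ≃ₐ[ℚ] K) {w w₀ : HeightOneSpectrum (𝓞 K)} (h : σ • w = w₀)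
    (t : w₀.adicCompletion K) (ht : t ∈ w₀.adicCompletionIntegers K) (y : w.adicCompletion K)
    (hy : y = galAdicCompletionMap σ⁻¹ (inv_smul_eq_of_smul_eq h) t) :
    y ∈ w.adicCompletionIntegers K := by
  rw [hy]
  exact (galAdicCompletionMap_mem_adicCompletionIntegers_iff K σ⁻¹ (inv_smul_eq_of_smul_eq h) t).mpr ht

end SemiLocal

end Summit.BirchSwinnertonDyer.BirchSwinnertonDyer.Theorems.SemiLocalDescent

end
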